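import Literature.Probability.RandomPlanarGeometry.LoopWinding
import HarnessLib

/-!
# Winding conditions on continuously varying loops are closed

Topic `Literature/Probability/RandomPlanarGeometry`, complement to `LoopWinding.lean` (stability of
the winding number `Curve.wind`).  If loops `Φ p` depend continuously on a parameter `p`, then for
every set `T ⊆ ℂ` of test points and every set `V ⊆ ℤ` of admissible values CONTAINING `0`, the
condition "`(Φ p).wind z ∈ V` for all `z ∈ T`" is closed in `p` (`Curve.isClosed_setOf_forall_wind_mem`,
`CurveClass.isClosed_setOf_forall_wind_mem`): at a violating parameter the bad test point is off
the trace (on the trace the junk value `0 ∈ V` is taken), and the winding number around it is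
locally constant in `p` (`Curve.wind_eq_of_reparamDist_lt`).  In particular "winds non-negatively
around every point of `T`" (`V = {n | 0 ≤ n}`: the left–right relation *weakly beyond* of route
`CriticalPhenomena/SAWTargetMonotonicity`, `SAW.WeaklyBeyond`) and "winding number `0` or `1`
everywhere" are closed conditions, so left–right relations between random chords defined through
a continuous loop-building map have CLOSED GRAPHS — the hypothesis under which Hall/Strassen
stochastic domination passes to weak limits.

## References

* Standard degree theory: local constancy of the winding number under uniform perturbations
  smaller than the distance to the trace (e.g. W. Fulton, *Algebraic Topology*, §3b).
-/

noncomputable section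

open Set Metric Filter Topology

namespace Literature.Probability.RandomPlanarGeometry

namespace Curve

variable {P : Type*} [TopologicalSpace P]

/-- **Violating a winding condition is an open condition.** For a continuous family of loops
`Φ p` and `0 ∈ V`, the set of parameters at which SOME test point `z ∈ T` has winding number
outside `V` is open. [folklore] -/
theorem isOpen_setOf_exists_wind_not_mem {Φ : P → Curve ℂ} (hΦ : Continuous Φ)
    (hloop : ∀ p, (Φ p).IsLoop) (T : Set ℂ) {V : Set ℤ} (hV : (0 : ℤ) ∈ V) :
    IsOpen {p | ∃ z ∈ T, (Φ p).wind z ∉ V} := by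
  rw [isOpen_iff_mem_nhds]
  rintro p ⟨z, hzT, hz⟩
  -- the bad point is off the trace
  have hzr : z ∉ (Φ p).range := fun h => hz (by rw [wind_of_mem_range h]; exact hV)
  have hd : 0 < infDist z (Φ p).range :=
    ((Φ p).isCompact_range.isClosed.notMem_iff_infDist_pos (Φ p).range_nonempty).1 hzr
  have hnear : ∀ᶠ q in 𝓝 p, dist (Φ q) (Φ p) < infDist z (Φ p).range :=
    (Metric.tendsto_nhds.1 hΦ.continuousAt) _ hd
  refine hnear.mono fun q hq => ⟨z, hzT, ?_⟩
  have hq' : reparamDist (Φ p) (Φ q) < infDist z (Φ p).range := by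
    rwa [← Curve.dist_def, dist_comm]
  rwa [wind_eq_of_reparamDist_lt (hloop p) (hloop q) hq']

/-- **Winding conditions are closed.** For a continuous family of loops `Φ p`, a set `T` of test
points and a set `V ∋ 0` of admissible values, `{p | ∀ z ∈ T, (Φ p).wind z ∈ V}` is closed.
[folklore] -/
theorem isClosed_setOf_forall_wind_mem {Φ : P → Curve ℂ} (hΦ : Continuous Φ)
    (hloop : ∀ p, (Φ p).IsLoop) (T : Set ℂ) {V : Set ℤ} (hV : (0 : ℤ) ∈ V) :
    IsClosed {p | ∀ z ∈ T, (Φ p).wind z ∈ V} := by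
  have h := isOpen_setOf_exists_wind_not_mem hΦ hloop T hV
  rw [← isClosed_compl_iff] at h
  convert h using 1
  ext p
  simp only [mem_setOf_eq, mem_compl_iff, not_exists, not_and, not_not]

/-- "Winds non-negatively around every point of `T`" is a closed condition on a continuous family
of loops (the relation *weakly beyond* of `SAW.WeaklyBeyond`, read in the continuum). [folklore] -/
theorem isClosed_setOf_forall_wind_nonneg {Φ : P → Curve ℂ} (hΦ : Continuous Φ)
    (hloop : ∀ p, (Φ p).IsLoop) (T : Set ℂ) : IsClosed {p | ∀ z ∈ T, 0 ≤ (Φ p).wind z} :=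
  isClosed_setOf_forall_wind_mem hΦ hloop T (V := {n : ℤ | 0 ≤ n}) (Set.mem_setOf_eq ▸ le_rfl)

end Curve

namespace CurveClass

variable {P : Type*} [TopologicalSpace P]

/-- A curve class whose endpoints agree is represented by loops only. [folklore] -/
theorem isLoop_of_mk_eq {c : CurveClass ℂ} (hc : c.source = c.target) {γ : Curve ℂ}
    (hγ : mk γ = c) : γ.IsLoop := by
  subst hγ
  rwa [Curve.isLoop_iff, ← source_mk, ← target_mk]

/-- **Violating a winding condition is open, for curve classes.** [folklore] -/
theorem isOpen_setOf_exists_wind_not_mem {Φ : P → CurveClass ℂ} (hΦ : Continuous Φ)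
    (hloop : ∀ p, (Φ p).source = (Φ p).target) (T : Set ℂ) {V : Set ℤ} (hV : (0 : ℤ) ∈ V) :
    IsOpen {p | ∃ z ∈ T, (Φ p).wind z ∉ V} := by
  rw [isOpen_iff_mem_nhds]
  rintro p ⟨z, hzT, hz⟩
  obtain ⟨γ, hγ⟩ := surjective_mk (Φ p)
  have hγloop : γ.IsLoop := isLoop_of_mk_eq (hloop p) hγ
  have hzγ : (Φ p).wind z = γ.wind z := by rw [← hγ, wind_mk]
  have hzr : z ∉ γ.range := fun h => hz (by rw [hzγ, Curve.wind_of_mem_range h]; exact hV)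
  have hd : 0 < infDist z γ.range :=
    (γ.isCompact_range.isClosed.notMem_iff_infDist_pos γ.range_nonempty).1 hzr
  have hnear : ∀ᶠ q in 𝓝 p, dist (Φ q) (Φ p) < infDist z γ.range :=
    (Metric.tendsto_nhds.1 hΦ.continuousAt) _ hd
  refine hnear.mono fun q hq => ⟨z, hzT, ?_⟩
  obtain ⟨γ', hγ'⟩ := surjective_mk (Φ q)
  have hγ'loop : γ'.IsLoop := isLoop_of_mk_eq (hloop q) hγ'
  have hq' : Curve.reparamDist γ γ' < infDist z γ.range := by
    rwa [← hγ, ← hγ', dist_mk_mk, dist_comm, Curve.dist_def] at hq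
  rw [← hγ', wind_mk, Curve.wind_eq_of_reparamDist_lt hγloop hγ'loop hq', ← hzγ]
  exact hz

/-- **Winding conditions are closed, for curve classes**: for a continuous family of loop classes
`Φ p` (`source = target`), test points `T` and admissible values `V ∋ 0`,
`{p | ∀ z ∈ T, (Φ p).wind z ∈ V}` is closed. [folklore] -/
theorem isClosed_setOf_forall_wind_mem {Φ : P → CurveClass ℂ} (hΦ : Continuous Φ)
    (hloop : ∀ p, (Φ p).source = (Φ p).target) (T : Set ℂ) {V : Set ℤ} (hV : (0 : ℤ) ∈ V) :
    IsClosed {p | ∀ z ∈ T, (Φ p).wind z ∈ V} := by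
  have h := isOpen_setOf_exists_wind_not_mem hΦ hloop T hV
  rw [← isClosed_compl_iff] at h
  convert h using 1
  ext p
  simp only [mem_setOf_eq, mem_compl_iff, not_exists, not_and, not_not]

/-- "Winds non-negatively around every point of `T`" is closed for a continuous family of loop
classes. [folklore] -/
theorem isClosed_setOf_forall_wind_nonneg {Φ : P → CurveClass ℂ} (hΦ : Continuous Φ)
    (hloop : ∀ p, (Φ p).source = (Φ p).target) (T : Set ℂ) :
    IsClosed {p | ∀ z ∈ T, 0 ≤ (Φ p).wind z} :=
  isClosed_setOf_forall_wind_mem hΦ hloop T (V := {n : ℤ | 0 ≤ n}) (Set.mem_setOf_eq ▸ le_rfl)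

/-- **Closed graph of a winding relation.** If `L x y` is a loop class built continuously from
two curve classes (e.g. `x · β · y⁻¹` for chords `x`, `y` and a fixed connecting arc `β`), then the
relation "`L x y` winds non-negatively around every point of `T`" has a closed graph in
`CurveClass ℂ × CurveClass ℂ` — the closedness hypothesis of
`StochDominatedAlong.measure_le_of_tendsto_of_isCompact`. [folklore] -/
theorem isClosed_setOf_forall_wind_nonneg₂ {L : CurveClass ℂ → CurveClass ℂ → CurveClass ℂ}
    (hL : Continuous fun p : CurveClass ℂ × CurveClass ℂ => L p.1 p.2)
    (hloop : ∀ x y, (L x y).source = (L x y).target) (T : Set ℂ) :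
    IsClosed {p : CurveClass ℂ × CurveClass ℂ | ∀ z ∈ T, 0 ≤ (L p.1 p.2).wind z} :=
  isClosed_setOf_forall_wind_nonneg hL (fun p => hloop p.1 p.2) T

end CurveClass

end Literature.Probability.RandomPlanarGeometry

end
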